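import Summits.RiemannHypothesis.RiemannHypothesis.Theorems.WeilColumnCeilings
import Summits.RiemannHypothesis.RiemannHypothesis.Theorems.HandoffWallMotion
import Summits.RiemannHypothesis.RiemannHypothesis.Theorems.SemilocalNegCert055747
import Literature.Computability.AlgebraicComplexity.BigCwOmegaBoundSharp
import HarnessLib

/-!
# WEIL column, rung W-P(P3) — the wall law typed as an ENVELOPE with explicit constants (RH-FREE; W-P(P3) pen, rh-explicit weil-1 gen22)

RH-FREE throughout.  HONEST FRAMING: `δ*(q) = wallOffset q = a*(S_q) − (log q)/2` is a number of the TRUNCATED Weil form keeping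
the primes `< q`; every statement below is an UPPER bound on it or pure logic about such bounds.  RH is the LOWER clause
`∀ q, 0 ≤ δ*(q)` (`HandoffMarginLaw.riemannHypothesis_iff_forall_wallOffset_nonneg`); nothing here bears on the truth of RH.

WHY AN ENVELOPE (director-rh WORD no. 7/8, 2026-08-26; A4-owner cc-s2-3 item (6); cc-s2-7).  The W-D data fork at `q ≤ 61` rejects
«one smooth power law for the wall constant `C(q) := δ*(q)·2 q^{3/2} log q`» at the %-level (χ² = 82 on 4 dof; `C(61)` sits 2–4 % above
every registered shape) while every certified wall `5 ≤ q ≤ 61` has `C(q) ∈ [0.087, 0.092]`.  So the P3 target of record is not a trend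
law but the ENVELOPE `sup_q C(q) ≤ C̄`: in the tree's currency `OneConstantWallCeiling C̄ q₀` (`WeilColumnCeilings`, cc-s2-3) from an
explicit small `q₀` with an explicit `C̄`.

WHAT THIS FILE ADDS.
§1 `wallConstant q` (= the tables' `C(q)`) and `δ*(q) ≤ oneConstantScale c q ↔ C(q) ≤ c` (`q ≥ 3`).
§2 `WallEnvelope C̄ := OneConstantWallCeiling C̄ 2` (EVERY prime), monotone in `C̄`; it implies the existential P3 leaf
   `SemilocalOneConstantCeiling` and the exponent-3/2 ceiling `DodgerWallCeiling (C̄/2) 3`.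
§3 **Why explicit constants are the content (THEOREM, RH-free logic):** under `¬RH` the offsets are eventually `a₀ − (log q)/2 → −∞`
   (`HandoffWallMotion`), so `¬RH → OneConstantWallCeiling c q₀` for EVERY `c ≥ 0` from some `q₀`; hence the existential leaves
   `SemilocalOneConstantCeiling`, `SemilocalTowerCeiling` are each EQUIVALENT to their own RH-conditional versions
   (`X ↔ (RH → X)`): their mathematical content is an RH-conditional RATE law.  An RH-free theorem with content must name `(C̄, q₀)`.
§4 The kernel HEAD of the envelope at `C̄ = 1/10`: `C(2) < 0.0986` (from `a*(∅) ≤ 0.3717`) and `C(3) < 0.0933` (from `a*({2}) ≤ 97/174`;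
   `log 3` to 7 digits from `Literature.Computability.AlgebraicComplexity.BigCwOmegaBoundSharp`),
   i.e. `δ*(q) ≤ oneConstantScale (1/10) q` at `q = 2, 3` — PROVED; for `5 ≤ q ≤ 61` the walls are CERTIFIED two-engine (kit; SEMILOCAL-TABLE
   §1b/§1d, A4-EXT-THRESHOLDS v0.50: `C(q) ≤ 0.0917`) but the tree's kernel rows are window-coarse (`δ*(q) < 0.007`,
   `SemilocalKinkedWallOffsets`), so no kernel claim is made there.
§5 The proposed P3 constant of record `WallEnvelopeTenth := WallEnvelope (1/10)` — «for every prime q, δ*(q) ≤ 1/(20 q^{3/2} log q)» —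
   a closed `Prop` (D-0061 leaf shape); OPEN.  What would discharge it: a `MarkovWitnessFamilyAtScale (oneConstantScale (1/10)) 5`
   (uniform kinked witnesses, `WeilColumnCeilings.wallCeilingAtScale_of_markovWitnessFamily`) plus §4.  What it gives: the dodger ceiling
   with `C = 1/20` from `q = 3` and (again) the class-law tail.  The data margin: 2 % at `q = 2` (kernel), ≥ 8 % at `5 ≤ q ≤ 61` (certified).

References: H. Yoshida, Adv. Stud. Pure Math. 21 (1992) Prop. 6 [`Yoshida1992HermitianForms`]; E. Bombieri, Rend. Mat. Acc. Lincei (9) 11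
(2000) Thm 2 [`Bombieri2000Weil`].  The envelope sentence is this cell's (HOME/STRUCTURE.md §2, SEMILOCAL-TABLE), not in print as far as searched.
-/

set_option linter.dupNamespace false  -- the mandated namespace repeats `RiemannHypothesis`
set_option autoImplicit false

noncomputable section

open Set Finset Literature.NumberTheory.LFunctions
open Summit.RiemannHypothesis.RiemannHypothesis.Theorems
open Summit.RiemannHypothesis.RiemannHypothesis.Theorems.MotivicDoor.SemilocalThreshold
open Summit.RiemannHypothesis.RiemannHypothesis.Theorems.HandoffMarginLaw (wallOffset)
open Summit.RiemannHypothesis.RiemannHypothesis.Theorems.HandoffDecomposition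
open Summit.RiemannHypothesis.RiemannHypothesis.Theorems.Handoff
open Summit.RiemannHypothesis.RiemannHypothesis.Theorems.SemilocalPolyWitness

namespace Summit.RiemannHypothesis.RiemannHypothesis.Theorems.WeilColumn

/-! ## §1  The wall constant `C(q)` -/

/-- **The wall constant** `C(q) := δ*(q) · 2 q^{3/2} log q` — the normalisation of the W-D tables (`δ*(q) = C(q)/(w_q q²)`,
`w_q = 2 log q/√q`); certified values `C(q) ∈ [0.087, 0.092]` for every prime `5 ≤ q ≤ 61`. [this cell, SEMILOCAL-TABLE §1b; RH-FREE] -/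
def wallConstant (q : ℕ) : ℝ := wallOffset q * (2 * (q : ℝ) ^ (3 / 2 : ℝ) * Real.log q)

/-- The normalising factor `2 q^{3/2} log q` is positive for `q ≥ 2`. [elementary] -/
theorem two_mul_rpow_mul_log_pos {q : ℕ} (hq : 2 ≤ q) : 0 < 2 * (q : ℝ) ^ (3 / 2 : ℝ) * Real.log q := by
  have hq1 : (1 : ℝ) < q := by exact_mod_cast (show 1 < q by omega)
  have hq0 : (0 : ℝ) < q := by linarith
  exact mul_pos (mul_pos two_pos (Real.rpow_pos_of_pos hq0 _)) (Real.log_pos hq1)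

/-- `δ*(q) ≤ c/(2 q^{3/2} log q) ↔ C(q) ≤ c` for `q ≥ 2`. [elementary] -/
theorem wallOffset_le_oneConstantScale_iff {c : ℝ} {q : ℕ} (hq : 2 ≤ q) :
    wallOffset q ≤ oneConstantScale c q ↔ wallConstant q ≤ c := by
  unfold oneConstantScale wallConstant
  rw [le_div_iff₀ (two_mul_rpow_mul_log_pos hq)]

/-- A one-constant ceiling from `q₀ ≥ 2` is exactly `∀ primes q ≥ q₀, C(q) ≤ c`. [elementary] -/
theorem oneConstantWallCeiling_iff_forall_wallConstant_le {c : ℝ} {q₀ : ℕ} (hq₀ : 2 ≤ q₀) :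
    OneConstantWallCeiling c q₀ ↔ ∀ q : ℕ, q.Prime → q₀ ≤ q → wallConstant q ≤ c := by
  refine forall₃_congr fun q _ hq ↦ ?_
  exact wallOffset_le_oneConstantScale_iff (hq₀.trans hq)

/-! ## §2  The envelope from the first prime -/

/-- **RH-FREE TARGET SHAPE (W-P(P3) envelope).** `WallEnvelope C̄`: for EVERY prime `q`, `δ*(q) ≤ C̄/(2 q^{3/2} log q)` — the
one-constant ceiling from `q₀ = 2`, i.e. `sup_q C(q) ≤ C̄`. [this cell; director-rh WORD no. 7 (2026-08-26), cc-s2-3 A4-owner item (6)] -/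
def WallEnvelope (C : ℝ) : Prop := OneConstantWallCeiling C 2

/-- The envelope is `∀ primes q, C(q) ≤ C̄`. [elementary] -/
theorem wallEnvelope_iff_forall_wallConstant_le {C : ℝ} :
    WallEnvelope C ↔ ∀ q : ℕ, q.Prime → wallConstant q ≤ C := by
  rw [WallEnvelope, oneConstantWallCeiling_iff_forall_wallConstant_le le_rfl]
  exact forall₂_congr fun q hq ↦ ⟨fun h ↦ h hq.two_le, fun h _ ↦ h⟩

/-- Envelopes are monotone in the constant. [elementary] -/
theorem WallEnvelope.mono {C C' : ℝ} (h : WallEnvelope C) (hCC' : C ≤ C') : WallEnvelope C' :=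
  fun q hq hq₂ ↦ (h q hq hq₂).trans (oneConstantScale_mono hCC' q)

/-- An envelope restricts to a one-constant ceiling from any `q₀`. [elementary] -/
theorem WallEnvelope.oneConstantWallCeiling {C : ℝ} (h : WallEnvelope C) (q₀ : ℕ) : OneConstantWallCeiling C q₀ :=
  fun q hq _ ↦ h q hq hq.two_le

/-- An envelope gives the existential P3 leaf `SemilocalOneConstantCeiling`. [elementary] -/
theorem WallEnvelope.semilocalOneConstantCeiling {C : ℝ} (h : WallEnvelope C) : SemilocalOneConstantCeiling :=
  ⟨C, 2, h⟩

/-- **An envelope with `C̄ ≥ 0` gives the exponent-3/2 ceiling `DodgerWallCeiling (C̄/2) 3`** (`δ*(q) ≤ (C̄/2)(log q)^{3/2}q^{−3/2}` for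
every prime `q ≥ 3`). [this column, `dodgerWallCeiling_of_oneConstant`] -/
theorem WallEnvelope.dodgerWallCeiling {C : ℝ} (h : WallEnvelope C) (hC : 0 ≤ C) : DodgerWallCeiling (C / 2) 3 := by
  have h3 : DodgerWallCeiling (C / 2) (max 2 3) := dodgerWallCeiling_of_oneConstant hC (by linarith) h
  simpa using h3

/-! ## §3  Why explicit constants are the content: the `¬RH` branch makes every EXISTENTIAL ceiling trivial -/

/-- **Under `¬RH`, every one-constant ceiling with `c ≥ 0` holds from some prime on** — past the failing increment the offsets are
`a₀ − (log q)/2` (`HandoffWallMotion.wallOffset_eq_of_not_handoffStep`), negative for large `q`, while the scale is `≥ 0`.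
[this cell; RH-FREE logic; cite: Yoshida1992HermitianForms, Prop. 6 (p. 320)] -/
theorem exists_oneConstantWallCeiling_of_not_riemannHypothesis {c : ℝ} (hc : 0 ≤ c)
    (hRH : ¬ Summit.RiemannHypothesis) : ∃ q₀ : ℕ, OneConstantWallCeiling c q₀ := by
  obtain ⟨q₁, hq₁, hfail⟩ := exists_not_handoffStep_of_not_riemannHypothesis hRH
  refine ⟨max (q₁ + 1) (⌈Real.exp (2 * (weilPositivityThreshold - 0))⌉₊ + 1), fun q hq hq₀ ↦ ?_⟩
  have h1 : q₁ < q := Nat.lt_of_succ_le ((le_max_left _ _).trans hq₀)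
  have h2 : Real.exp (2 * (weilPositivityThreshold - 0)) < q := by
    have h3 : ⌈Real.exp (2 * (weilPositivityThreshold - 0))⌉₊ < q := Nat.lt_of_succ_le ((le_max_right _ _).trans hq₀)
    have h4 : ((⌈Real.exp (2 * (weilPositivityThreshold - 0))⌉₊ : ℕ) : ℝ) < q := by exact_mod_cast h3
    exact (Nat.le_ceil _).trans_lt h4
  have hneg : wallOffset q < 0 := wallOffset_lt_of_not_handoffStep hq₁ hfail h1 h2
  have hscale : 0 ≤ oneConstantScale c q := by
    unfold oneConstantScale
    exact div_nonneg hc (mul_nonneg (mul_nonneg (by norm_num) (Real.rpow_nonneg (Nat.cast_nonneg q) _))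
      (Real.log_natCast_nonneg q))
  exact hneg.le.trans hscale

/-- **Under `¬RH`, every ceiling at a non-negative scale holds from some prime on.** [this cell; RH-FREE logic] -/
theorem exists_wallCeilingAtScale_of_not_riemannHypothesis {s : ℕ → ℝ} (hs : ∀ q : ℕ, 0 ≤ s q)
    (hRH : ¬ Summit.RiemannHypothesis) : ∃ q₀ : ℕ, WallCeilingAtScale s q₀ := by
  obtain ⟨q₀, h⟩ := exists_oneConstantWallCeiling_of_not_riemannHypothesis le_rfl hRH
  refine ⟨q₀, fun q hq hq₀ ↦ (h q hq hq₀).trans ?_⟩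
  have : oneConstantScale 0 q = 0 := by simp [oneConstantScale]
  rw [this]
  exact hs q

/-- **`¬RH → SemilocalOneConstantCeiling`.** [this cell; RH-FREE logic] -/
theorem semilocalOneConstantCeiling_of_not_riemannHypothesis (hRH : ¬ Summit.RiemannHypothesis) :
    SemilocalOneConstantCeiling := by
  obtain ⟨q₀, h⟩ := exists_oneConstantWallCeiling_of_not_riemannHypothesis le_rfl hRH
  exact ⟨0, q₀, h⟩

/-- **`¬RH → SemilocalTowerCeiling`.** [this cell; RH-FREE logic] -/
theorem semilocalTowerCeiling_of_not_riemannHypothesis (hRH : ¬ Summit.RiemannHypothesis) :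
    SemilocalTowerCeiling := by
  obtain ⟨q₀, h⟩ := exists_wallCeilingAtScale_of_not_riemannHypothesis (s := towerScale 0 0)
    (fun q ↦ by unfold towerScale; positivity) hRH
  exact ⟨0, 0, q₀, h⟩

/-- **The existential one-constant leaf is its own RH-conditional version**: `SemilocalOneConstantCeiling ↔ (RH → SemilocalOneConstantCeiling)`.
Its content is therefore an RH-CONDITIONAL rate law; an RH-free theorem with content must name the constants (§2, §5). [this cell; RH-FREE logic] -/
theorem semilocalOneConstantCeiling_iff_of_riemannHypothesis :
    SemilocalOneConstantCeiling ↔ (Summit.RiemannHypothesis → SemilocalOneConstantCeiling) :=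
  ⟨fun h _ ↦ h, fun h ↦ (em Summit.RiemannHypothesis).elim h semilocalOneConstantCeiling_of_not_riemannHypothesis⟩

/-- **The existential tower leaf is its own RH-conditional version.** [this cell; RH-FREE logic] -/
theorem semilocalTowerCeiling_iff_of_riemannHypothesis :
    SemilocalTowerCeiling ↔ (Summit.RiemannHypothesis → SemilocalTowerCeiling) :=
  ⟨fun h _ ↦ h, fun h ↦ (em Summit.RiemannHypothesis).elim h semilocalTowerCeiling_of_not_riemannHypothesis⟩

/-- By contrast an ENVELOPE does not follow from `¬RH` for free: it bounds `δ*(q)` at EVERY prime, including those below the (ineffective)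
failing increment.  Formally: `WallEnvelope C̄ ↔ (finite head ∧ tail)` for any cut `Q`. [elementary] -/
theorem wallEnvelope_iff_head_and_tail (C : ℝ) (Q : ℕ) :
    WallEnvelope C ↔ (∀ q : ℕ, q.Prime → q < Q → wallOffset q ≤ oneConstantScale C q) ∧ OneConstantWallCeiling C Q :=
  ⟨fun h ↦ ⟨fun q hq _ ↦ h q hq hq.two_le, h.oneConstantWallCeiling Q⟩,
    fun h q hq _ ↦ (Nat.lt_or_ge q Q).elim (h.1 q hq) (h.2 q hq)⟩

/-! ## §4  The kernel head at `C̄ = 1/10`: `q = 2` and `q = 3` -/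

/-- `2^{3/2} = 2√2 < 2.8284272`. [elementary] -/
theorem two_rpow_three_halves_lt_d7 : (2 : ℝ) ^ (3 / 2 : ℝ) < 2.8284272 := by
  rw [rpow_three_halves_eq_sqrt_pow 2 (by norm_num)]
  have hs : Real.sqrt 2 < 1.4142136 := by
    rw [Real.sqrt_lt' (by norm_num)]
    norm_num
  have h2 : Real.sqrt 2 ^ 2 = 2 := Real.sq_sqrt (by norm_num)
  have h3 : Real.sqrt 2 ^ 3 = 2 * Real.sqrt 2 := by rw [pow_succ, h2]
  rw [h3]
  linarith

/-- `3^{3/2} = 3√3 < 5.1961525`. [elementary] -/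
theorem three_rpow_three_halves_lt_d7 : (3 : ℝ) ^ (3 / 2 : ℝ) < 5.1961525 := by
  rw [rpow_three_halves_eq_sqrt_pow 3 (by norm_num)]
  have hs : Real.sqrt 3 < 1.73205081 := by
    rw [Real.sqrt_lt' (by norm_num)]
    norm_num
  have h2 : Real.sqrt 3 ^ 2 = 3 := Real.sq_sqrt (by norm_num)
  have h3 : Real.sqrt 3 ^ 3 = 3 * Real.sqrt 3 := by rw [pow_succ, h2]
  rw [h3]
  linarith

/-- **`δ*(2) ≤ 0.3717 − (log 2)/2 < 0.02513`** (`a*(∅) ≤ 0.3717`, `SemilocalNegCertEmpty`; DATA `0.0250`). [this cell; tree certificate] -/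
theorem wallOffset_two_le : wallOffset 2 ≤ 3717 / 10000 - Real.log 2 / 2 := by
  have h := weilSemilocalThreshold_empty_le_03717
  push_cast at h
  rw [wallOffset, HandoffUpperClauses.primesBelow_two]
  push_cast
  linarith

/-- **`C(2) < 0.0986`** (kernel; DATA `C(2) ≈ 0.098`). [this cell; tree certificate] -/
theorem wallConstant_two_lt : wallConstant 2 < 0.0986 := by
  have hδ : wallOffset 2 < 0.02513 := by
    have h := wallOffset_two_le
    have h2 := Real.log_two_gt_d9
    linarith
  have hlog : Real.log (2 : ℕ) < 0.6931471808 := by exact_mod_cast Real.log_two_lt_d9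
  have hlog0 : 0 < Real.log (2 : ℕ) := Real.log_pos (by norm_num)
  have hpow : ((2 : ℕ) : ℝ) ^ (3 / 2 : ℝ) < 2.8284272 := by exact_mod_cast two_rpow_three_halves_lt_d7
  have hpow0 : 0 < ((2 : ℕ) : ℝ) ^ (3 / 2 : ℝ) := Real.rpow_pos_of_pos (by norm_num) _
  have hw : 2 * ((2 : ℕ) : ℝ) ^ (3 / 2 : ℝ) * Real.log (2 : ℕ) < 3.92104 := by
    have := mul_lt_mul'' hpow hlog hpow0.le hlog0.le
    nlinarith
  have hw0 : 0 < 2 * ((2 : ℕ) : ℝ) ^ (3 / 2 : ℝ) * Real.log (2 : ℕ) := by positivity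
  unfold wallConstant
  by_cases h0 : wallOffset 2 ≤ 0
  · exact (mul_nonpos_of_nonpos_of_nonneg h0 hw0.le).trans_lt (by norm_num)
  · push Not at h0
    nlinarith

/-- **`δ*(3) ≤ 97/174 − (log 3)/2 < 0.008166`** (`a*({2}) ≤ 97/174`, `SemilocalNegCert055747`; DATA `0.0080`). [this cell; tree certificate] -/
theorem wallOffset_three_le : wallOffset 3 ≤ 97 / 174 - Real.log 3 / 2 := by
  have h := weilSemilocalThreshold_two_le_055747
  push_cast at h
  rw [wallOffset, HandoffUpperClauses.primesBelow_three]
  push_cast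
  linarith

/-- **`C(3) < 0.0933`** (kernel; DATA `C(3) ≈ 0.091`). [this cell; tree certificate] -/
theorem wallConstant_three_lt : wallConstant 3 < 0.0933 := by
  have hδ : wallOffset 3 < 0.008166 := by
    have h := wallOffset_three_le
    have h3 := Literature.Computability.AlgebraicComplexity.log_three_gt_d7
    linarith
  have hlog : Real.log (3 : ℕ) < 1.0986124 := by
    exact_mod_cast Literature.Computability.AlgebraicComplexity.log_three_lt_d7
  have hlog0 : 0 < Real.log (3 : ℕ) := Real.log_pos (by norm_num)
  have hpow : ((3 : ℕ) : ℝ) ^ (3 / 2 : ℝ) < 5.1961525 := by exact_mod_cast three_rpow_three_halves_lt_d7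
  have hpow0 : 0 < ((3 : ℕ) : ℝ) ^ (3 / 2 : ℝ) := Real.rpow_pos_of_pos (by norm_num) _
  have hw : 2 * ((3 : ℕ) : ℝ) ^ (3 / 2 : ℝ) * Real.log (3 : ℕ) < 11.41712 := by
    have := mul_lt_mul'' hpow hlog hpow0.le hlog0.le
    nlinarith
  have hw0 : 0 < 2 * ((3 : ℕ) : ℝ) ^ (3 / 2 : ℝ) * Real.log (3 : ℕ) := by positivity
  unfold wallConstant
  by_cases h0 : wallOffset 3 ≤ 0
  · exact (mul_nonpos_of_nonpos_of_nonneg h0 hw0.le).trans_lt (by norm_num)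
  · push Not at h0
    nlinarith

/-! ## §5  The proposed P3 constant of record and its kernel head -/

/-- **W-P(P3) ENVELOPE OF RECORD (proposed; RH-FREE; OPEN)**: «for every prime `q`, `δ*(q) ≤ 1/(20 q^{3/2} log q)`», i.e.
`sup_q C(q) ≤ 1/10`.  EVIDENCE (not proof): kernel `C(2) < 0.0986`, `C(3) < 0.0933` (§4); certified two-engine walls `C(q) ≤ 0.0917`
for every prime `5 ≤ q ≤ 61` (SEMILOCAL-TABLE §1b/§1d); open beyond `61`.  NOT implied by `¬RH` (§3 applies only eventually);
under RH it is a quantitative rate law sharper than the dodger ceiling by `(log q)^{5/2}`. [this cell; director-rh WORD no. 7/8 2026-08-26] -/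
def WallEnvelopeTenth : Prop := WallEnvelope (1 / 10)

/-- **Kernel head of the envelope of record**: at `q = 2` and `q = 3`, `δ*(q) ≤ 1/(20 q^{3/2} log q)`. [this cell; tree certificates] -/
theorem wallEnvelopeTenth_head {q : ℕ} (hq : q.Prime) (hq3 : q ≤ 3) :
    wallOffset q ≤ oneConstantScale (1 / 10) q := by
  rw [wallOffset_le_oneConstantScale_iff hq.two_le]
  have h2 := hq.two_le
  interval_cases q
  · exact (wallConstant_two_lt.trans (by norm_num : (0.0986 : ℝ) < 1 / 10)).le
  · exact (wallConstant_three_lt.trans (by norm_num : (0.0933 : ℝ) < 1 / 10)).le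

/-- **The envelope of record, reduced to its tail from `q = 5`**: `WallEnvelopeTenth ↔ OneConstantWallCeiling (1/10) 5`
(`4` is not prime; the head `q ≤ 3` is §4). [this cell] -/
theorem wallEnvelopeTenth_iff_from_five : WallEnvelopeTenth ↔ OneConstantWallCeiling (1 / 10) 5 := by
  rw [WallEnvelopeTenth, wallEnvelope_iff_head_and_tail (1 / 10) 5]
  refine ⟨fun h ↦ h.2, fun h ↦ ⟨fun q hq hq5 ↦ wallEnvelopeTenth_head hq ?_, h⟩⟩
  by_contra h4
  have : q = 4 := by omega
  exact (by decide : ¬ (4 : ℕ).Prime) (this ▸ hq)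

/-- **What would discharge it**: a Markov (kinked) witness family at the scale `1/(20 q^{3/2} log q)` from `q = 5`. [this column, §1b reduction] -/
theorem wallEnvelopeTenth_of_markovWitnessFamily
    (h : MarkovWitnessFamilyAtScale (oneConstantScale (1 / 10)) 5) : WallEnvelopeTenth :=
  wallEnvelopeTenth_iff_from_five.2 (wallCeilingAtScale_of_markovWitnessFamily h)

/-- **What it would give**: the exponent-3/2 ceiling `δ*(q) ≤ (1/20)(log q)^{3/2} q^{−3/2}` for every prime `q ≥ 3` (the dodger proves
`1/5` from `q = 1015`). [this column] -/
theorem dodgerWallCeiling_of_wallEnvelopeTenth (h : WallEnvelopeTenth) : DodgerWallCeiling (1 / 20) 3 := by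
  have := WallEnvelope.dodgerWallCeiling h (by norm_num)
  norm_num at this
  exact this

end Summit.RiemannHypothesis.RiemannHypothesis.Theorems.WeilColumn

end
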